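import Summits.ResolutionOfSingularities.ResolutionOfSingularities.Theorems.WeightedInvariantLocalWeightedDropTrackCDefs
import Literature.AlgebraicGeometry.Resolution.AdicNoetherian
import Literature.AlgebraicGeometry.Resolution.PowerSeriesRegularLocal
import Literature.AlgebraicGeometry.Resolution.EmbeddedResolutionExcellentSurfacesSequence
import Literature.AlgebraicGeometry.Resolution.ProjectiveSpaceRegular
import Literature.AlgebraicGeometry.Resolution.CofinalityFromPrincipalization
import Literature.AlgebraicGeometry.Resolution.ExcellentRingsCompleteHolds
import Literature.AlgebraicGeometry.Resolution.AdicCompletionRegular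
import Literature.AlgebraicGeometry.Resolution.AlterationsFormalNodesRegular

/-!
# Track C: the base point of `Z₀ = Spec k⟦x₀,x₁,x₂⟧` and the Cossart–Jannsen–Saito input

[OURS · L1 W4.3 · chain w43, stub worker 4] Helper for TRACK C of the engine crux `LocalWeightedDrop`
(stmt-ResolutionOfSingularities-8899; skeleton `L/res-L1-w43-stub-4/TrackC_Skeleton.lean`; definitions
`Theorems/…TrackCDefs.lean`). NOT a statement of any manuscript.

* `won_of_wonAt_id` — BASE of the induction: `WonAt f (𝟙 Z₀)` wins `f` itself, through the tautological frame
  at the closed point of `Z₀` (the local ring there IS `k⟦x⟧`, already complete: `IsLocalization.atUnits`,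
  `AdicCompletion.ofAlgEquiv`), in which the total transform of `f` is `f`;
* `topologicalKrullDim_zeroLocus_le`, `exists_sequence` — the CJS INPUT: `Z₀` is Noetherian, regular and excellent
  (complete regular local ring: `isExcellentRing_of_isAdicComplete`), `V(f)` is closed of dimension `≤ 2` for
  `f ≠ 0` (`ringKrullDim_quotient_succ_le_of_nonZeroDivisor`), so `CossartJannsenSaito2020EmbeddedSequence.of_isClosed`
  yields the `𝓑`-permissible blow-up sequence `π : Z₁ ⟶ Z₀` with regular end, regular strict transform `X₁`, snc
  boundary `B₁`, `π⁻¹(V f) = X₁ ∪ B₁` and `X₁` transversal with `B₁`.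
-/

noncomputable section

open CategoryTheory AlgebraicGeometry TopologicalSpace IsLocalRing
open Literature.AlgebraicGeometry.Resolution

set_option linter.dupNamespace false -- mandated namespace of this single-conjunct summit

namespace Summit.ResolutionOfSingularities.ResolutionOfSingularities.Theorems.TrackC

variable {k : Type} [Field k]

/-! ## BASE: the tautological frame at the closed point of `Z₀` -/

section Base

variable (k)

/-- The local ring of `Z₀ = Spec k⟦x₀,x₁,x₂⟧` at its closed point is Noetherian. [OURS · folklore] -/
theorem isNoetherianRing_stalk_closedPoint :
    IsNoetherianRing ((Spec (.of (MvPowerSeries (Fin 3) k))).presheaf.stalk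
      (closedPoint (MvPowerSeries (Fin 3) k))) := by
  letI : Algebra (MvPowerSeries (Fin 3) k) ((Spec (.of (MvPowerSeries (Fin 3) k))).presheaf.stalk
      (closedPoint (MvPowerSeries (Fin 3) k))) :=
    StructureSheaf.stalkAlgebra (MvPowerSeries (Fin 3) k) (closedPoint (MvPowerSeries (Fin 3) k))
  haveI : IsLocalization.AtPrime ((Spec (.of (MvPowerSeries (Fin 3) k))).presheaf.stalk
      (closedPoint (MvPowerSeries (Fin 3) k))) (maximalIdeal (MvPowerSeries (Fin 3) k)) :=
    StructureSheaf.IsLocalization.to_stalk (MvPowerSeries (Fin 3) k) (closedPoint (MvPowerSeries (Fin 3) k))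
  haveI : IsNoetherianRing (MvPowerSeries (Fin 3) k) := isNoetherianRing_mvPowerSeries (Fin 3) (R := k)
  have H : (maximalIdeal (MvPowerSeries (Fin 3) k)).primeCompl ≤ IsUnit.submonoid (MvPowerSeries (Fin 3) k) :=
    fun x hx => by
      change IsUnit x
      by_contra hux
      exact hx ((IsLocalRing.mem_maximalIdeal x).mpr (mem_nonunits_iff.mpr hux))
  exact isNoetherianRing_of_ringEquiv (MvPowerSeries (Fin 3) k)
    (IsLocalization.atUnits (MvPowerSeries (Fin 3) k) (maximalIdeal (MvPowerSeries (Fin 3) k)).primeCompl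
      (S := (Spec (.of (MvPowerSeries (Fin 3) k))).presheaf.stalk (closedPoint (MvPowerSeries (Fin 3) k)))
      H).toRingEquiv

/-- **BASE.** `WonAt f (𝟙 Z₀)` wins `f` itself: the closed point of `Z₀ = Spec k⟦x₀,x₁,x₂⟧` carries the
tautological frame `𝒪̂_{Z₀,0} = k⟦x⟧^ ≅ k⟦x⟧` (constants to constants), in which the total transform of `f` along
`𝟙 Z₀` is `f`. [OURS · folklore] -/
theorem won_of_wonAt_id (f : MvPowerSeries (Fin 3) k)
    (h : WonAt f (𝟙 (Spec (.of (MvPowerSeries (Fin 3) k)))))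
    (hf : CobordantGame.IsSingular k f) : CobordantGame.Won k 3 f := by
  let z₀ : Spec (.of (MvPowerSeries (Fin 3) k)) := closedPoint (MvPowerSeries (Fin 3) k)
  let O : Type := (Spec (.of (MvPowerSeries (Fin 3) k))).presheaf.stalk z₀
  letI : Algebra (MvPowerSeries (Fin 3) k) O := StructureSheaf.stalkAlgebra (MvPowerSeries (Fin 3) k) z₀
  haveI : IsLocalization.AtPrime O (maximalIdeal (MvPowerSeries (Fin 3) k)) :=
    StructureSheaf.IsLocalization.to_stalk (MvPowerSeries (Fin 3) k) z₀
  haveI hRN : IsNoetherianRing (MvPowerSeries (Fin 3) k) := isNoetherianRing_mvPowerSeries (Fin 3) (R := k)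
  have H : (maximalIdeal (MvPowerSeries (Fin 3) k)).primeCompl ≤ IsUnit.submonoid (MvPowerSeries (Fin 3) k) :=
    fun x hx => by
      change IsUnit x
      by_contra hux
      exact hx ((IsLocalRing.mem_maximalIdeal x).mpr (mem_nonunits_iff.mpr hux))
  let ι : MvPowerSeries (Fin 3) k ≃ₐ[MvPowerSeries (Fin 3) k] O :=
    IsLocalization.atUnits (MvPowerSeries (Fin 3) k) (maximalIdeal (MvPowerSeries (Fin 3) k)).primeCompl H
  have hι : ∀ r : MvPowerSeries (Fin 3) k, ι r = algebraMap (MvPowerSeries (Fin 3) k) O r := fun r => by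
    simpa using ι.commutes r
  haveI hN : IsNoetherianRing O := isNoetherianRing_of_ringEquiv (MvPowerSeries (Fin 3) k) ι.toRingEquiv
  -- `O` is `𝔪`-adically complete, being isomorphic to `k⟦x⟧`
  haveI : IsAdicComplete (maximalIdeal (MvPowerSeries (Fin 3) k)) (MvPowerSeries (Fin 3) k) := by
    rw [maximalIdeal_mvPowerSeries_eq_span]
    infer_instance
  haveI : IsAdicComplete (maximalIdeal O) O := by
    have h1 := (IsAdicComplete.congr_ringEquiv (maximalIdeal (MvPowerSeries (Fin 3) k)) ι.toRingEquiv).mpr ‹_›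
    rwa [map_ringEquiv_maximalIdeal] at h1
  -- the tautological frame
  let e : AdicCompletion (maximalIdeal O) O ≃+* MvPowerSeries (Fin 3) k :=
    (AdicCompletion.ofAlgEquiv (maximalIdeal O)).symm.toRingEquiv.trans ι.symm.toRingEquiv
  have he : ∀ r : MvPowerSeries (Fin 3) k, e (algebraMap O _ (algebraMap (MvPowerSeries (Fin 3) k) O r)) = r :=
    fun r => by
      change ι.symm ((AdicCompletion.ofAlgEquiv (maximalIdeal O)).symm
        (AdicCompletion.of (maximalIdeal O) O (algebraMap (MvPowerSeries (Fin 3) k) O r))) = r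
      rw [AdicCompletion.ofAlgEquiv_symm_of, ← hι, AlgEquiv.symm_apply_apply]
  have hgerm : ∀ r : MvPowerSeries (Fin 3) k, (Spec (.of (MvPowerSeries (Fin 3) k))).presheaf.germ ⊤ z₀ trivial
      ((Scheme.ΓSpecIso (.of (MvPowerSeries (Fin 3) k))).inv.hom r) =
        algebraMap (MvPowerSeries (Fin 3) k) O r := fun r => rfl
  have hid : ∀ r : MvPowerSeries (Fin 3) k,
      (𝟙 (Spec (.of (MvPowerSeries (Fin 3) k))) : Spec (.of (MvPowerSeries (Fin 3) k)) ⟶ _).appTop.hom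
        ((Scheme.ΓSpecIso (.of (MvPowerSeries (Fin 3) k))).inv.hom r) =
        (Scheme.ΓSpecIso (.of (MvPowerSeries (Fin 3) k))).inv.hom r := fun r => by
    rw [Scheme.Hom.id_appTop]; rfl
  let F : @Frame k _ (Spec (.of (MvPowerSeries (Fin 3) k))) (𝟙 _) z₀ hN :=
    { e := e
      map_const := fun a => by
        change e (algebraMap O _ ((Spec (.of (MvPowerSeries (Fin 3) k))).presheaf.germ ⊤ z₀ trivial
          ((𝟙 (Spec (.of (MvPowerSeries (Fin 3) k))) : Spec (.of (MvPowerSeries (Fin 3) k)) ⟶ _).appTop.hom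
            ((Scheme.ΓSpecIso (.of (MvPowerSeries (Fin 3) k))).inv.hom (MvPowerSeries.C a))))) = _
        rw [hid, hgerm, he] }
  have hT : F.e (algebraMap _ _ (totalGerm (𝟙 (Spec (.of (MvPowerSeries (Fin 3) k)))) z₀ f)) = f := by
    change e (algebraMap O _ ((Spec (.of (MvPowerSeries (Fin 3) k))).presheaf.germ ⊤ z₀ trivial
      ((𝟙 (Spec (.of (MvPowerSeries (Fin 3) k))) : Spec (.of (MvPowerSeries (Fin 3) k)) ⟶ _).appTop.hom
        ((Scheme.ΓSpecIso (.of (MvPowerSeries (Fin 3) k))).inv.hom f)))) = f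
    rw [hid, hgerm, he]
  exact h z₀ hN F f (by rw [hT]) hf

end Base

/-! ## CJS INPUT: the sequence for `V(f) ⊆ Z₀` -/

section Input

variable (k)

/-- `V(f) ⊆ Spec k⟦x₀,x₁,x₂⟧` has topological Krull dimension `≤ 2` for `f ≠ 0`. [OURS · folklore] -/
theorem topologicalKrullDim_zeroLocus_le (f : MvPowerSeries (Fin 3) k) (hf : f ≠ 0) :
    topologicalKrullDim ((Spec (.of (MvPowerSeries (Fin 3) k))).zeroLocus (U := ⊤)
      {(Scheme.ΓSpecIso (.of (MvPowerSeries (Fin 3) k))).inv.hom f}) ≤ 2 := by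
  haveI : IsDomain (MvPowerSeries (Fin 3) k) := NoZeroDivisors.to_isDomain _
  have hV : ((Spec (.of (MvPowerSeries (Fin 3) k))).zeroLocus (U := ⊤)
      {(Scheme.ΓSpecIso (.of (MvPowerSeries (Fin 3) k))).inv.hom f} : Set _) =
      PrimeSpectrum.zeroLocus (Ideal.span {f} : Set (MvPowerSeries (Fin 3) k)) := by
    rw [← Set.image_singleton, Spec_zeroLocus_eq_zeroLocus, PrimeSpectrum.zeroLocus_span]
  have hker : RingHom.ker (Ideal.Quotient.mk (Ideal.span {f})) = Ideal.span {f} := Ideal.mk_ker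
  have hrange : Set.range (PrimeSpectrum.comap (Ideal.Quotient.mk (Ideal.span {f}))) =
      PrimeSpectrum.zeroLocus (Ideal.span {f} : Set (MvPowerSeries (Fin 3) k)) := by
    rw [range_comap_of_surjective _ _ Ideal.Quotient.mk_surjective, hker]
  have hemb := (PrimeSpectrum.isClosedEmbedding_comap_of_surjective _ _
    (Ideal.Quotient.mk_surjective (I := Ideal.span {f}))).isEmbedding
  have hhom := hemb.toHomeomorph.isHomeomorph
  have h1 : topologicalKrullDim (PrimeSpectrum (MvPowerSeries (Fin 3) k ⧸ Ideal.span {f})) =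
      topologicalKrullDim (Set.range (PrimeSpectrum.comap (Ideal.Quotient.mk (Ideal.span {f})))) :=
    IsHomeomorph.topologicalKrullDim_eq _ hhom
  have h2 : topologicalKrullDim ((Spec (.of (MvPowerSeries (Fin 3) k))).zeroLocus (U := ⊤)
      {(Scheme.ΓSpecIso (.of (MvPowerSeries (Fin 3) k))).inv.hom f}) =
      topologicalKrullDim (Set.range (PrimeSpectrum.comap (Ideal.Quotient.mk (Ideal.span {f})))) := by
    rw [hrange, ← hV]
    rfl
  rw [h2, ← h1, PrimeSpectrum.topologicalKrullDim_eq_ringKrullDim]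
  have h3 := ringKrullDim_quotient_succ_le_of_nonZeroDivisor (mem_nonZeroDivisors_of_ne_zero hf)
  rw [ringKrullDim_mvPowerSeries] at h3
  have h4 : ringKrullDim (MvPowerSeries (Fin 3) k ⧸ Ideal.span {f}) + 1 ≤ ((2 : ℕ) : WithBot ℕ∞) + 1 := by
    refine h3.trans (le_of_eq ?_)
    simp
    norm_num
  exact ENat.WithBot.add_le_add_one_right_iff.mp h4

-- REMOVE-WHEN the superseded fact `CossartJannsenSaito2020EmbeddedSequence` (refuted as typed, kernel certificate
-- `not_cossartJannsenSaito2020EmbeddedSequence`) is deleted from the tree: this consumer is kept for the record only; the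
-- live results are the `…B` forms (`TrackC.exists_sequence_zeroLocusB`, `TrackC.surfaceGermsWon_of_CJSSequenceB`).
set_option linter.deprecated false in
/-- **CJS INPUT.** For `f ≠ 0` the fact `CossartJannsenSaito2020EmbeddedSequence` applies to the closed subset
`V(f) ⊆ Z₀ = Spec k⟦x₀,x₁,x₂⟧` (Noetherian, regular, excellent) of dimension `≤ 2` with its reduced structure, and
yields a `𝓑`-permissible sequence `π : Z₁ ⟶ Z₀` with regular end `Z₁`, regular strict transform `X₁`, snc boundary
`B₁`, `π⁻¹(V f) = X₁ ∪ B₁` and `X₁` transversal with `B₁`. [OURS · folklore] -/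
theorem exists_sequence (hCJS : CossartJannsenSaito2020EmbeddedSequence.{0}) (f : MvPowerSeries (Fin 3) k)
    (hf : f ≠ 0) :
    ∃ (Z₁ : Scheme.{0}) (π : Z₁ ⟶ Spec (.of (MvPowerSeries (Fin 3) k))) (X₁ B₁ : Set Z₁)
      (X B : Set (Spec (.of (MvPowerSeries (Fin 3) k)))),
      IsBPermissibleSequence X B π X₁ B₁ ∧ Scheme.IsRegular Z₁ ∧
      Scheme.IsRegular
        (Scheme.IdealSheafData.vanishingIdeal ⟨closure X₁, isClosed_closure⟩).subscheme ∧
      IsStrictNormalCrossingsDivisor Z₁ B₁ ∧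
      π ⁻¹' ((Spec (.of (MvPowerSeries (Fin 3) k))).zeroLocus (U := ⊤)
        {(Scheme.ΓSpecIso (.of (MvPowerSeries (Fin 3) k))).inv.hom f} : Set _) = X₁ ∪ B₁ ∧
      IsTransversalWith Z₁ X₁ B₁ := by
  haveI : IsNoetherianRing (MvPowerSeries (Fin 3) k) := isNoetherianRing_mvPowerSeries (Fin 3) (R := k)
  haveI : IsRegularLocalRing (MvPowerSeries (Fin 3) k) := isRegularLocalRing_mvPowerSeries k (Fin 3)
  haveI : IsRegularRing (MvPowerSeries (Fin 3) k) := isRegularRing_of_isRegularLocalRing _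
  have hreg : Scheme.IsRegular (Spec (.of (MvPowerSeries (Fin 3) k))) := Scheme.isRegular_Spec (.of _)
  haveI : IsAdicComplete (maximalIdeal (MvPowerSeries (Fin 3) k)) (MvPowerSeries (Fin 3) k) := by
    rw [maximalIdeal_mvPowerSeries_eq_span]
    infer_instance
  have hexc : Scheme.IsExcellent (Spec (.of (MvPowerSeries (Fin 3) k))) :=
    Scheme.isExcellent_Spec_of_isExcellentRing _ (isExcellentRing_of_isAdicComplete _)
  have hVc : IsClosed ((Spec (.of (MvPowerSeries (Fin 3) k))).zeroLocus (U := ⊤)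
      {(Scheme.ΓSpecIso (.of (MvPowerSeries (Fin 3) k))).inv.hom f} : Set _) :=
    Scheme.zeroLocus_isClosed _ _
  obtain ⟨Z₁, π, X₁, B₁, hseq, hZ₁, -, -, -, hX₁, hB₁, htot, htr⟩ :=
    CossartJannsenSaito2020EmbeddedSequence.of_isClosed hCJS (Spec (.of (MvPowerSeries (Fin 3) k)))
      hreg hexc _ hVc (topologicalKrullDim_zeroLocus_le k f hf)
  exact ⟨Z₁, π, X₁, B₁, _, ∅, hseq, hZ₁, hX₁, hB₁, htot, htr⟩

end Input

end Summit.ResolutionOfSingularities.ResolutionOfSingularities.Theorems.TrackC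

end
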